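import Literature.Analysis.FluidPDE.LuoTitiStep
import Literature.Analysis.FluidPDE.LuoTitiParameters
import Literature.Analysis.FluidPDE.TorusLpOperatorFactsAntidivergenceProofs
import Literature.Analysis.FluidPDE.AntidivergenceDerivLp
import Literature.Analysis.FunctionSpaces.TorusRieszTransformProofs
import Mathlib.Geometry.Manifold.PartitionOfUnity
import Mathlib.Geometry.Manifold.ContMDiff.NormedSpace
import Mathlib.Analysis.Normed.Group.Bounded
import HarnessLib

/-!
# The Iteration Lemma of Luo–Titi (Luo–Titi 2020, Lemma 1 = §2.1 "Iteration Lemma"): the limits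
  along the parameter curve and the proof

Analysis/FluidPDE file (everything proved; no named facts) discharging the named fact
`Torus.LuoTiti2020_iterationLemma` (`FluidPDE/FractionalNSReynolds`): for `1 ≤ θ < 5/4`, `ν > 0`
there is `C > 0` such that every smooth compactly-(time-)supported solution `(v, p, R)` of the
fractional Navier–Stokes–Reynolds system (2.1) on `ℝ × 𝕋³` with `sup_t ‖R(t)‖_{L¹} ≤ δ₁` can be
corrected to a solution `(v', p', R')` with `sup_t‖R'(t)‖_{L¹} ≤ δ₂`, temporal supports in the
`δ₁`-neighbourhood of the old ones, `‖v'(t) - v(t)‖_{L²} ≤ C δ₁^{1/2}` and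
`‖v'(t) - v(t)‖_{L¹} ≤ δ₂`.

Part 1 (`LuoTiti.Consts.*`, §3.5 (3.21): "The Iteration Lemma holds by taking `λ_{q+1}`
sufficiently large"): along the curve of `LuoTitiParameters` (`κ = μ^{1-g}`, `σ = ⌈μ^{g/4}⌉`,
`μ′ = μ^{(1-g)/2+1+g/4}`, `p = 1 + g/64`, `g = 5/2 - 2θ`) the three size functions of
`LuoTitiStep` — the `L¹` increment bound `incL1`, the corrector energy `E_r`, the `L¹` stress bound
`stress` — and the `σ⁻¹`-part of the principal energy `E_p` tend to zero as `μ → ∞`, for fixed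
constants (`Consts.eventually_small`); the atoms are the limits of `LuoTitiParameters`, this part
does the algebra (`Datum.Keta/KetaD` in closed form, the sup bound `S₁ ≤ c_S σκ^{1/2}μ²` of the
local field, the measure bound of the jet supports) and the `Tendsto` bookkeeping.

Part 2 (`LuoTiti.iterationLemma_holds`): the assembly of the jet-based realisation of §3 built in
the sibling files — after a time translation placing the temporal support inside a slab
`[2δ₁, T - 2δ₁]`, a smooth cut-off `ψ` equal to `1` on `supp_t R` and supported in its
`δ₁`-neighbourhood (smooth Urysohn lemma), the intermittent-jet datum with floor `γ₀ = δ₁` and the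
stress `R` (amplitude bounds from `JAmp.jamp_package` and compactness), the perturbation
`w = ψ•wpc + ψ²•(X + ∇ζ)` (`LuoTitiPerturbation`), the identity `(⋆_ψ)`
(`LuoTitiPerturbationIdentity`), the new triple with the hyperviscous gradient part in the
pressure (`LuoTitiPerturbationFracNSR`), the size bounds at fixed parameters (`LuoTitiStep`, with
`LuoTitiEstimates`, `LuoTitiHyperviscous`), and the choice of a large parameter by Part 1. The
universal constant is `C = (40 N_Λ / r₃ + 1)^{1/2} + 1` (`N_Λ` directions, `r₃` the Nash radius):
`‖w‖_{L²}² ≲ ∫ρ ≲ γ₀ + ∫‖R‖`. The building blocks are the tree's intermittent jets rather than the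
printed intermittent Beltrami flows; the statement proved is exactly the vendored Lemma 1.

## References

* T. Luo, E. S. Titi, Calc. Var. PDE 59 (2020) = arXiv:1808.07595, §2.1 Iteration Lemma
  (Lemma 1) with (2.1)–(2.5), §3, (3.17)–(3.21). [`LuoTiti2020`]
* T. Buckmaster, V. Vicol, EMS Surv. Math. Sci. 6 (2019) = arXiv:1901.09023, §7. [`BuckmasterVicol2020`]
-/

noncomputable section

/-! # Part 1: the limits along the parameter curve -/


open MeasureTheory Set Filter Topology Function UnitAddTorus
open scoped InnerProductSpace ContDiff ENNReal NNReal

namespace Literature.Analysis.FluidPDE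

namespace LuoTiti

open Literature.Analysis.FunctionSpaces FunctionSpaces.Torus Mikado NashGeometric Jet JetStep Param

local notation "𝕋³" => UnitAddTorus (Fin 3)
local notation "E³" => EuclideanSpace ℝ (Fin 3)
local notation "Idx" => Index (Fin 3)

/-- **The datum along the curve**: slab, floor, stress and bump fixed; `(μ, κ, σ, μ′)` on the curve
of exponent `θ`. [cite: LuoTiti2020, §3.5 (3.21)] -/
def Dof (T γ₀ : ℝ) (M : ℝ → 𝕋³ → Fin 3 → E³) (g : ℝ → ℝ) (θ μ : ℝ) : Datum :=
  ⟨T, γ₀, M, μ, κθ θ μ, σθ θ μ, mupθ θ μ, g⟩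

namespace Consts

variable (c : Consts) (T γ₀ : ℝ) (M : ℝ → 𝕋³ → Fin 3 → E³) (g : ℝ → ℝ)

/-- Nonnegativity of the constants (all that is needed for the limits). [folklore] -/
structure Nonneg (c : Consts) : Prop where
  hA₀ : 0 ≤ c.A₀
  hA₁ : 0 ≤ c.A₁
  hH₁ : 0 ≤ c.H₁
  hH₂ : 0 ≤ c.H₂
  hB : 1 ≤ c.B
  hC₂ : 0 ≤ c.C₂
  hCℛ : 0 ≤ c.Cℛ
  hC₁ : 0 ≤ c.C₁
  hCh : 0 ≤ c.Ch
  hK : 0 ≤ c.K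
  hCa : 0 ≤ c.Ca
  hV₀ : 0 ≤ c.V₀
  hΨ₁ : 0 ≤ c.Ψ₁
  hvB : 0 ≤ c.vB
  hθ1 : 1 ≤ c.θ
  hθ2 : c.θ < 5 / 4
  hpr : c.pr = pexp c.θ

variable {c}
variable (hc : c.Nonneg)
include hc

omit hc in
/-- Unfolding of the parameters of `Dof`. [folklore] -/
theorem Dof_params (μ : ℝ) : (Dof T γ₀ M g c.θ μ).μ = μ ∧ (Dof T γ₀ M g c.θ μ).κ = κθ c.θ μ ∧
    (Dof T γ₀ M g c.θ μ).σ = σθ c.θ μ ∧ (Dof T γ₀ M g c.θ μ).mup = mupθ c.θ μ ∧ (Dof T γ₀ M g c.θ μ).γ₀ = γ₀ :=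
  ⟨rfl, rfl, rfl, rfl, rfl⟩

/-! ### The increment and the corrector energy -/

/-- `Lp → 0`. [folklore] -/
theorem tendsto_Lp : Tendsto (fun μ => c.Lp (Dof T γ₀ M g c.θ μ)) atTop (𝓝 0) := by
  have h := Param.tendsto_Lp hc.hθ1 hc.hθ2 (NN * (3 * c.A₀ * c.B))
  refine h.congr fun μ => ?_
  show _ = NN * (3 * c.A₀ * (c.B * κθ c.θ μ ^ (-(1 / 2 : ℝ)) * μ⁻¹))
  ring

/-- `Lc → 0`. [folklore] -/
theorem tendsto_Lc : Tendsto (fun μ => c.Lc (Dof T γ₀ M g c.θ μ)) atTop (𝓝 0) := by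
  obtain ⟨g0, g1, -, -, -, -⟩ := gap_bounds hc.hθ1 hc.hθ2
  have ha := (Param.tendsto_Lc hc.hθ1 hc.hθ2 (NN * (3 * (c.B * (5 * c.A₀))))).1
  have hb := tendsto_monomial' hc.hθ1 hc.hθ2 (α := -(1 / 2)) (β := -1) (γ := 0) (δ := -2) (by simp only [mexp]; nlinarith)
    (NN * (3 * (c.B * (36 * c.A₁))))
  have hb' : Tendsto (fun μ => NN * (3 * (c.B * (36 * c.A₁))) * (κθ c.θ μ ^ (-(1 / 2 : ℝ)) * ((σθ c.θ μ : ℝ))⁻¹ * μ ^ (-(2 : ℝ))))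
      atTop (𝓝 0) := by
    refine hb.congr' ?_
    filter_upwards [eventually_ge_atTop (1 : ℝ)] with μ hμ
    rw [Real.rpow_zero, Real.rpow_neg_one]; ring
  have := ha.add hb'
  rw [add_zero] at this
  refine this.congr fun μ => ?_
  show _ = NN * (3 * (c.B * (5 * c.A₀ * (κθ c.θ μ ^ (1 / 2 : ℝ) * μ ^ (-(2 : ℝ))) +
      36 * c.A₁ * (κθ c.θ μ ^ (-(1 / 2 : ℝ)) * ((σθ c.θ μ : ℝ))⁻¹ * μ ^ (-(2 : ℝ))))))
  ring

/-- `Sc · Lc → 0` (`≲ κ²μ⁻²`; needs `a > 0`). [folklore] -/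
theorem tendsto_ScLc : Tendsto (fun μ => c.Sc (Dof T γ₀ M g c.θ μ) * c.Lc (Dof T γ₀ M g c.θ μ)) atTop (𝓝 0) := by
  obtain ⟨g0, g1, -, -, -, -⟩ := gap_bounds hc.hθ1 hc.hθ2
  have hA0 := hc.hA₀; have hA1 := hc.hA₁
  have hB0 : 0 ≤ c.B := zero_le_one.trans hc.hB
  have hNN : 0 < NN := zero_lt_one.trans_le one_le_NN
  set P : ℝ := NN * (3 * c.B ^ 2) * (5 * c.A₀ + 36 * c.A₁) with hP
  set Q : ℝ := NN * (3 * c.B) * (5 * c.A₀ + 36 * c.A₁) with hQ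
  have hlim := (Param.tendsto_Lc hc.hθ1 hc.hθ2 (P * Q)).2
  refine tendsto_zero_of_abs_le hlim fun μ hμ => ?_
  obtain ⟨hκ0, hκ1, -, hσ0, hσ1, -, hm0, -⟩ := scheme_basic hc.hθ1 hc.hθ2 hμ
  have hμ0 : 0 < μ := zero_lt_one.trans_le hμ
  have hσ0' : (0 : ℝ) < σθ c.θ μ := by exact_mod_cast hσ0
  set κ := κθ c.θ μ
  set σ : ℝ := (σθ c.θ μ : ℝ)
  have hσ1' : 1 ≤ σ := le_trans (Real.one_le_rpow hμ (by linarith)) hσ1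
  have hσi : σ⁻¹ ≤ 1 := inv_le_one_of_one_le₀ hσ1'
  have k1 : κ ^ (1 / 2 : ℝ) ≤ κ ^ (3 / 2 : ℝ) := Real.rpow_le_rpow_of_exponent_le hκ1 (by norm_num)
  have k2 : κ ^ (-(1 / 2) : ℝ) ≤ κ ^ (1 / 2 : ℝ) := Real.rpow_le_rpow_of_exponent_le hκ1 (by norm_num)
  have p12 : 0 < κ ^ (1 / 2 : ℝ) := Real.rpow_pos_of_pos hκ0 _
  have p32 : 0 < κ ^ (3 / 2 : ℝ) := Real.rpow_pos_of_pos hκ0 _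
  have pm : 0 < μ ^ (-(2 : ℝ)) := Real.rpow_pos_of_pos hμ0 _
  have eSc : c.Sc (Dof T γ₀ M g c.θ μ) = NN * (3 * (c.B ^ 2 * (5 * c.A₀ * κ ^ (3 / 2 : ℝ) + 36 * c.A₁ * κ ^ (1 / 2 : ℝ) * σ⁻¹))) := rfl
  have eLc : c.Lc (Dof T γ₀ M g c.θ μ) = NN * (3 * (c.B * (5 * c.A₀ * (κ ^ (1 / 2 : ℝ) * μ ^ (-(2 : ℝ))) +
      36 * c.A₁ * (κ ^ (-(1 / 2) : ℝ) * σ⁻¹ * μ ^ (-(2 : ℝ)))))) := rfl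
  have bSc : c.Sc (Dof T γ₀ M g c.θ μ) ≤ P * κ ^ (3 / 2 : ℝ) := by
    rw [eSc, hP]
    have : κ ^ (1 / 2 : ℝ) * σ⁻¹ ≤ κ ^ (3 / 2 : ℝ) := by
      calc κ ^ (1 / 2 : ℝ) * σ⁻¹ ≤ κ ^ (1 / 2 : ℝ) * 1 := mul_le_mul_of_nonneg_left hσi p12.le
        _ ≤ κ ^ (3 / 2 : ℝ) := by rw [mul_one]; exact k1
    nlinarith [mul_nonneg (mul_nonneg hNN.le (sq_nonneg c.B)) hA1]
  have bLc : c.Lc (Dof T γ₀ M g c.θ μ) ≤ Q * (κ ^ (1 / 2 : ℝ) * μ ^ (-(2 : ℝ))) := by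
    rw [eLc, hQ]
    have : κ ^ (-(1 / 2) : ℝ) * σ⁻¹ * μ ^ (-(2 : ℝ)) ≤ κ ^ (1 / 2 : ℝ) * μ ^ (-(2 : ℝ)) := by
      have : κ ^ (-(1 / 2) : ℝ) * σ⁻¹ ≤ κ ^ (1 / 2 : ℝ) := by
        calc κ ^ (-(1 / 2) : ℝ) * σ⁻¹ ≤ κ ^ (-(1 / 2) : ℝ) * 1 := mul_le_mul_of_nonneg_left hσi (Real.rpow_nonneg hκ0.le _)
          _ ≤ κ ^ (1 / 2 : ℝ) := by rw [mul_one]; exact k2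
      exact mul_le_mul_of_nonneg_right this pm.le
    nlinarith [mul_nonneg (mul_nonneg hNN.le hB0) hA1]
  have nSc : 0 ≤ c.Sc (Dof T γ₀ M g c.θ μ) := by rw [eSc]; positivity
  have nLc : 0 ≤ c.Lc (Dof T γ₀ M g c.θ μ) := by rw [eLc]; positivity
  rw [abs_of_nonneg (mul_nonneg nSc nLc)]
  calc c.Sc (Dof T γ₀ M g c.θ μ) * c.Lc (Dof T γ₀ M g c.θ μ) ≤ (P * κ ^ (3 / 2 : ℝ)) * (Q * (κ ^ (1 / 2 : ℝ) * μ ^ (-(2 : ℝ)))) :=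
        mul_le_mul bSc bLc nLc (by positivity)
    _ = P * Q * ((κ ^ (3 / 2 : ℝ) * κ ^ (1 / 2 : ℝ)) * μ ^ (-(2 : ℝ))) := by ring
    _ = P * Q * (κ ^ (2 : ℝ) * μ ^ (-(2 : ℝ))) := by rw [← Real.rpow_add hκ0]; norm_num

/-- `EX → 0`. [folklore] -/
theorem tendsto_EX : Tendsto (fun μ => c.EX (Dof T γ₀ M g c.θ μ)) atTop (𝓝 0) := by
  have h := Param.tendsto_EX hc.hθ1 hc.hθ2 (NN * (NN * (9 * (c.A₀ ^ 4 * c.B))))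
  refine h.congr fun μ => ?_
  show _ = NN * (NN * (9 * ((mupθ c.θ μ)⁻¹) ^ 2 * (c.A₀ ^ 4 * (c.B * κθ c.θ μ * μ ^ 2))))
  ring

/-- `Eζ → 0`. [folklore] -/
theorem tendsto_Eζ : Tendsto (fun μ => c.Eζ (Dof T γ₀ M g c.θ μ)) atTop (𝓝 0) := by
  have h := (((tendsto_EX T γ₀ M g hc).sqrt.const_mul 2).const_mul c.C₂).const_mul 3
  have h2 := (h.pow 2).const_mul 3
  simp only [Real.sqrt_zero, mul_zero] at h2
  norm_num at h2
  exact h2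

/-- `Er → 0`. [cite: LuoTiti2020, §3.4 (3.14)] -/
theorem tendsto_Er : Tendsto (fun μ => c.Er (Dof T γ₀ M g c.θ μ)) atTop (𝓝 0) := by
  have h := (((tendsto_ScLc T γ₀ M g hc).add (tendsto_EX T γ₀ M g hc)).add (tendsto_Eζ T γ₀ M g hc)).const_mul 3
  simp only [add_zero, mul_zero] at h
  exact h

/-- `incL1 → 0`. [cite: LuoTiti2020, §3.4 (3.15)] -/
theorem tendsto_incL1 : Tendsto (fun μ => c.incL1 (Dof T γ₀ M g c.θ μ)) atTop (𝓝 0) := by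
  have h := (((tendsto_Lp T γ₀ M g hc).add (tendsto_Lc T γ₀ M g hc)).add (tendsto_EX T γ₀ M g hc).sqrt).add (tendsto_Eζ T γ₀ M g hc).sqrt
  simp only [Real.sqrt_zero, add_zero] at h
  exact h

/-- The `σ⁻¹` part of `Ep` tends to zero. [folklore] -/
theorem tendsto_Ep_tail : Tendsto (fun μ => NN * (5 * (3 * c.H₁ * (Real.sqrt 3 / (σθ c.θ μ : ℝ))))) atTop (𝓝 0) := by
  have h := Param.tendsto_inv_σ hc.hθ1 hc.hθ2 (NN * (5 * (3 * c.H₁ * Real.sqrt 3)))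
  refine h.congr fun μ => ?_
  rw [div_eq_mul_inv]; ring

/-! ### The sources -/

/-- `LS, Lf₂, Lf₃ → 0`. [folklore] -/
theorem tendsto_LS_Lf₂_Lf₃ : Tendsto (fun μ => c.LS (Dof T γ₀ M g c.θ μ)) atTop (𝓝 0) ∧
    Tendsto (fun μ => c.Lf₂ (Dof T γ₀ M g c.θ μ)) atTop (𝓝 0) ∧ Tendsto (fun μ => c.Lf₃ (Dof T γ₀ M g c.θ μ)) atTop (𝓝 0) := by
  refine ⟨?_, ?_, ?_⟩
  · refine (Param.tendsto_inv_σ hc.hθ1 hc.hθ2 (NN * (2 * (27 * c.H₁) * (3 * c.B)))).congr fun μ => ?_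
    show _ = NN * (2 * (27 * c.H₁) * (3 * (c.B * ((σθ c.θ μ : ℝ))⁻¹))); ring
  · refine (Param.tendsto_inv_σ hc.hθ1 hc.hθ2 (NN * ((2 * 3 + 1) * (27 * c.H₂) * (3 * c.B)))).congr fun μ => ?_
    show _ = NN * ((2 * 3 + 1) * (27 * c.H₂) * (3 * (c.B * ((σθ c.θ μ : ℝ))⁻¹))); ring
  · refine (Param.tendsto_inv_mup hc.hθ1 hc.hθ2 (NN * (3 * c.H₁))).congr fun μ => ?_
    show _ = NN * (3 * (mupθ c.θ μ)⁻¹ * c.H₁); ring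

omit hc in
/-- **`Keta`, `KetaD` in closed form**: `K_η = B²σ⁻¹κ^{1/2-1/p}μ^{-2/p}`,
`K_{η′} = B²σ⁻¹κ^{3/2-1/p}μ^{-2/p}` (`B, κ, σ, μ > 0`, `p ≥ 1`). [folklore] -/
theorem Keta_closed_form {D : Datum} (hμ : 0 < D.μ) (hκ : 0 < D.κ) (hσ : 0 < D.σ) {B p : ℝ} (hB : 0 < B) (hp : 1 ≤ p) :
    D.Keta B p = B ^ 2 * (((D.σ : ℝ))⁻¹ * D.κ ^ (1 / 2 - 1 / p) * D.μ ^ (-(2 / p))) ∧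
    D.KetaD B p = B ^ 2 * (((D.σ : ℝ))⁻¹ * D.κ ^ (3 / 2 - 1 / p) * D.μ ^ (-(2 / p))) := by
  have hp0 : 0 < p := by linarith
  have hσ' : (0 : ℝ) < D.σ := by exact_mod_cast hσ
  have hσi : 0 ≤ ((D.σ : ℝ))⁻¹ := by positivity
  have hW : 0 ≤ B * D.μ ^ (-(2 / p)) := by positivity
  have e1 : (((D.σ : ℝ))⁻¹ ^ p) ^ (1 / p) = ((D.σ : ℝ))⁻¹ := by
    rw [← Real.rpow_mul hσi, mul_one_div_cancel hp0.ne', Real.rpow_one]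
  have e3 : ((B * D.μ ^ (-(2 / p))) ^ p) ^ (1 / p) = B * D.μ ^ (-(2 / p)) := by
    rw [← Real.rpow_mul hW, mul_one_div_cancel hp0.ne', Real.rpow_one]
  have key : ∀ s : ℝ, ((D.κ ^ s * B) ^ (p - 1) * (D.κ ^ (s - 1) * B)) ^ (1 / p) = D.κ ^ (s - 1 / p) * B := by
    intro s
    have hks : 0 < D.κ ^ s := Real.rpow_pos_of_pos hκ _
    have hY : (D.κ ^ s * B) ^ (p - 1) * (D.κ ^ (s - 1) * B) = D.κ ^ (s * p - 1) * B ^ p := by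
      rw [Real.mul_rpow hks.le hB.le, ← Real.rpow_mul hκ.le]
      have : D.κ ^ (s * (p - 1)) * B ^ (p - 1) * (D.κ ^ (s - 1) * B) = (D.κ ^ (s * (p - 1)) * D.κ ^ (s - 1)) * (B ^ (p - 1) * B) := by ring
      rw [this, ← Real.rpow_add hκ, ← Real.rpow_add_one hB.ne']
      congr 1 <;> ring_nf
    rw [hY, Real.mul_rpow (Real.rpow_nonneg hκ.le _) (Real.rpow_nonneg hB.le _), ← Real.rpow_mul hκ.le, ← Real.rpow_mul hB.le,
      mul_one_div_cancel hp0.ne', Real.rpow_one]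
    congr 1
    rw [sub_mul, one_mul, mul_assoc, mul_one_div_cancel hp0.ne', mul_one]
  have k1 := key (1 / 2)
  have k2 := key (3 / 2)
  rw [show (1 / 2 : ℝ) - 1 = -(1 / 2) by norm_num] at k1
  rw [show (3 / 2 : ℝ) - 1 = 1 / 2 by norm_num] at k2
  have hX : 0 ≤ ((D.σ : ℝ))⁻¹ ^ p := Real.rpow_nonneg hσi _
  have hY1 : 0 ≤ (D.κ ^ (1 / 2 : ℝ) * B) ^ (p - 1) * (D.κ ^ (-(1 / 2) : ℝ) * B) := by positivity
  have hY2 : 0 ≤ (D.κ ^ (3 / 2 : ℝ) * B) ^ (p - 1) * (D.κ ^ (1 / 2 : ℝ) * B) := by positivity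
  have hWp : 0 ≤ (B * D.μ ^ (-(2 / p))) ^ p := Real.rpow_nonneg hW _
  constructor
  · unfold Datum.Keta
    rw [Real.mul_rpow (mul_nonneg hX hY1) hWp, Real.mul_rpow hX hY1, e1, k1, e3]
    ring
  · unfold Datum.KetaD
    rw [Real.mul_rpow (mul_nonneg hX hY2) hWp, Real.mul_rpow hX hY2, e1, k2, e3]
    ring

/-- `Lf₁ → 0` (the time-derivative term). [cite: LuoTiti2020, §3.5 (3.18)] -/
theorem tendsto_Lf₁ : Tendsto (fun μ => c.Lf₁ (Dof T γ₀ M g c.θ μ)) atTop (𝓝 0) := by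
  obtain ⟨g0, g1, p1, p2, -, -⟩ := gap_bounds hc.hθ1 hc.hθ2
  have hB : 0 < c.B := zero_lt_one.trans_le hc.hB
  obtain ⟨h1, h2⟩ := Param.tendsto_Lf₁ hc.hθ1 hc.hθ2 (1 : ℝ)
  have := ((h1.const_mul (NN * (c.Cℛ * (3 * (3 * (6 * c.A₁ * c.B ^ 2)))))).add (h2.const_mul (NN * (c.Cℛ * (3 * (3 * (30 * c.A₀ * c.B ^ 2)))))))
  rw [mul_zero, mul_zero, add_zero] at this
  refine this.congr' ?_
  filter_upwards [eventually_ge_atTop (1 : ℝ)] with μ hμ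
  obtain ⟨hκ0, -, -, hσ0, -, -, hm0, -⟩ := scheme_basic hc.hθ1 hc.hθ2 hμ
  have hμ0 : 0 < μ := zero_lt_one.trans_le hμ
  obtain ⟨k1, k2⟩ := Keta_closed_form (D := Dof T γ₀ M g c.θ μ) hμ0 hκ0 hσ0 hB (p := c.pr) (by rw [hc.hpr]; exact p1.le)
  show _ = NN * (c.Cℛ * (3 * (3 * (6 * c.A₁ * (Dof T γ₀ M g c.θ μ).Keta c.B c.pr +
    30 * ((Dof T γ₀ M g c.θ μ).σ : ℝ) * (Dof T γ₀ M g c.θ μ).mup * c.A₀ * (Dof T γ₀ M g c.θ μ).KetaD c.B c.pr))))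
  rw [k1, k2, hc.hpr]
  simp only [Dof]
  ring

/-! ### The hyperviscous size -/

/-- **The sup bound of the local field on the curve**: `S₁ ≤ c_S σ κ^{1/2} μ²` and
`3 S₁ L⋆² ≤ 27Λ₀² c_S σ³κ^{1/2}μ⁴`, `c_S = N_Λ Ca K Λ₀ (432 Λ₀ + 4608 Ca)`. [cite: LuoTiti2020, §3.5 (3.16)] -/
theorem S₁_le {μ : ℝ} (hμ : 1 ≤ μ) :
    let cS : ℝ := NN * (c.Ca * c.K * Jet.frameConst (Fin 3) * (432 * Jet.frameConst (Fin 3) + 4608 * c.Ca))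
    0 ≤ c.S₁ (Dof T γ₀ M g c.θ μ) ∧
    c.S₁ (Dof T γ₀ M g c.θ μ) ≤ cS * ((σθ c.θ μ : ℝ) * κθ c.θ μ ^ (1 / 2 : ℝ) * μ ^ (2 : ℝ)) ∧
    3 * (c.S₁ (Dof T γ₀ M g c.θ μ) * (Dof T γ₀ M g c.θ μ).Lstar ^ 2) ≤
      (27 * Jet.frameConst (Fin 3) ^ 2 * cS) * (((σθ c.θ μ : ℝ)) ^ (3 : ℝ) * κθ c.θ μ ^ (1 / 2 : ℝ) * μ ^ (4 : ℝ)) := by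
  intro cS
  obtain ⟨hκ0, hκ1, -, hσ0, -, -, hm0, hsm⟩ := scheme_basic hc.hθ1 hc.hθ2 hμ
  have hμ0 : 0 < μ := zero_lt_one.trans_le hμ
  have hσ0' : (0 : ℝ) < σθ c.θ μ := by exact_mod_cast hσ0
  have hΛ := Jet.one_le_frameConst (d := Fin 3)
  have hΛ0 : 0 < Jet.frameConst (Fin 3) := zero_lt_one.trans_le hΛ
  have hNN : 0 < NN := zero_lt_one.trans_le one_le_NN
  have hCa := hc.hCa; have hK := hc.hK
  set κ := κθ c.θ μ with hκdef
  set σ : ℝ := (σθ c.θ μ : ℝ) with hσdef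
  set m := mupθ c.θ μ with hmdef
  have hL : (Dof T γ₀ M g c.θ μ).Lstar = 3 * Jet.frameConst (Fin 3) * σ * μ := rfl
  have hsq : Real.sqrt κ = κ ^ (1 / 2 : ℝ) := Real.sqrt_eq_rpow κ
  have hs0 : 0 < Real.sqrt κ := Real.sqrt_pos.2 hκ0
  -- the two terms of `S₁`
  have eS : c.S₁ (Dof T γ₀ M g c.θ μ) = NN * (3 * (2 ^ 4 * c.Ca * (c.K * Real.sqrt κ * σ⁻¹) * (3 * Jet.frameConst (Fin 3) * σ * μ))) * (3 * Jet.frameConst (Fin 3) * σ * μ) +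
      NN * (2 ^ 3 * (m⁻¹ * (2 ^ 3 * (2 ^ 3 * c.Ca * c.Ca) * (c.K * κ * μ ^ 2))) * 3) * (3 * Jet.frameConst (Fin 3) * σ * μ) := rfl
  have t1 : NN * (3 * (2 ^ 4 * c.Ca * (c.K * Real.sqrt κ * σ⁻¹) * (3 * Jet.frameConst (Fin 3) * σ * μ))) * (3 * Jet.frameConst (Fin 3) * σ * μ) =
      (NN * (c.Ca * c.K * Jet.frameConst (Fin 3) * (432 * Jet.frameConst (Fin 3)))) * (σ * Real.sqrt κ * μ ^ 2) := by
    field_simp; ring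
  have t2 : NN * (2 ^ 3 * (m⁻¹ * (2 ^ 3 * (2 ^ 3 * c.Ca * c.Ca) * (c.K * κ * μ ^ 2))) * 3) * (3 * Jet.frameConst (Fin 3) * σ * μ) ≤
      (NN * (c.Ca * c.K * Jet.frameConst (Fin 3) * (4608 * c.Ca))) * (σ * Real.sqrt κ * μ ^ 2) := by
    -- `κ μ³ / μ′ ≤ κ^{1/2} μ²` from `κ^{1/2} μ ≤ μ′`
    have hkey : m⁻¹ * (κ * μ ^ 2) * μ ≤ Real.sqrt κ * μ ^ 2 := by
      have e : m⁻¹ * (κ * μ ^ 2) * μ = (κ * μ ^ 3) / m := by rw [div_eq_inv_mul]; ring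
      rw [e, div_le_iff₀ hm0]
      have hss := Real.mul_self_sqrt hκ0.le
      calc κ * μ ^ 3 = (Real.sqrt κ * μ ^ 2) * (Real.sqrt κ * μ) := by linear_combination (-(μ ^ 3)) * hss
        _ ≤ (Real.sqrt κ * μ ^ 2) * m := mul_le_mul_of_nonneg_left hsm (by positivity)
    calc NN * (2 ^ 3 * (m⁻¹ * (2 ^ 3 * (2 ^ 3 * c.Ca * c.Ca) * (c.K * κ * μ ^ 2))) * 3) * (3 * Jet.frameConst (Fin 3) * σ * μ)
        = (NN * (c.Ca * c.K * Jet.frameConst (Fin 3) * (4608 * c.Ca))) * σ * (m⁻¹ * (κ * μ ^ 2) * μ) := by ring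
      _ ≤ (NN * (c.Ca * c.K * Jet.frameConst (Fin 3) * (4608 * c.Ca))) * σ * (Real.sqrt κ * μ ^ 2) :=
          mul_le_mul_of_nonneg_left hkey (by positivity)
      _ = _ := by ring
  have hS₁0 : 0 ≤ c.S₁ (Dof T γ₀ M g c.θ μ) := by rw [eS]; positivity
  have hS₁le : c.S₁ (Dof T γ₀ M g c.θ μ) ≤ cS * (σ * κ ^ (1 / 2 : ℝ) * μ ^ (2 : ℝ)) := by
    rw [eS, t1, Real.rpow_two, ← hsq]
    calc _ ≤ (NN * (c.Ca * c.K * Jet.frameConst (Fin 3) * (432 * Jet.frameConst (Fin 3)))) * (σ * Real.sqrt κ * μ ^ 2) +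
          (NN * (c.Ca * c.K * Jet.frameConst (Fin 3) * (4608 * c.Ca))) * (σ * Real.sqrt κ * μ ^ 2) := add_le_add le_rfl t2
      _ = cS * (σ * Real.sqrt κ * μ ^ 2) := by simp only [cS]; ring
  refine ⟨hS₁0, hS₁le, ?_⟩
  have e4 : σ ^ (3 : ℝ) * κ ^ (1 / 2 : ℝ) * μ ^ (4 : ℝ) = (σ * κ ^ (1 / 2 : ℝ) * μ ^ (2 : ℝ)) * (σ * μ) ^ 2 := by
    rw [show (4 : ℝ) = 2 + 2 by norm_num, Real.rpow_add hμ0, Real.rpow_two, show (3 : ℝ) = ((3 : ℕ) : ℝ) by norm_num, Real.rpow_natCast]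
    ring
  rw [e4, hL]
  calc 3 * (c.S₁ (Dof T γ₀ M g c.θ μ) * (3 * Jet.frameConst (Fin 3) * σ * μ) ^ 2)
      = (27 * Jet.frameConst (Fin 3) ^ 2) * (c.S₁ (Dof T γ₀ M g c.θ μ) * (σ * μ) ^ 2) := by ring
    _ ≤ (27 * Jet.frameConst (Fin 3) ^ 2) * ((cS * (σ * κ ^ (1 / 2 : ℝ) * μ ^ (2 : ℝ))) * (σ * μ) ^ 2) :=
        mul_le_mul_of_nonneg_left (mul_le_mul_of_nonneg_right hS₁le (by positivity)) (by positivity)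
    _ = _ := by ring

/-- `Hν → 0` (the hyperviscous term, LT (3.20): needs `θ < 5/4`). [cite: LuoTiti2020, §3.5 (3.20)] -/
theorem tendsto_Hν : Tendsto (fun μ => c.Hν (Dof T γ₀ M g c.θ μ)) atTop (𝓝 0) := by
  obtain ⟨g0, g1, p1, p2, -, -⟩ := gap_bounds hc.hθ1 hc.hθ2
  have hθ2' : c.θ < 2 := by linarith [hc.hθ2]
  set cS : ℝ := NN * (c.Ca * c.K * Jet.frameConst (Fin 3) * (432 * Jet.frameConst (Fin 3) + 4608 * c.Ca)) with hcS
  set cS' : ℝ := 27 * Jet.frameConst (Fin 3) ^ 2 * cS with hcS'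
  have hΛ := Jet.one_le_frameConst (d := Fin 3)
  have hNN : 0 < NN := zero_lt_one.trans_le one_le_NN
  have hCa := hc.hCa; have hK := hc.hK; have hCh := hc.hCh; have hvB := hc.hvB
  have hcS0 : 0 ≤ cS := by positivity
  have hcS'0 : 0 ≤ cS' := by positivity
  set q : ℝ := 1 / c.pr with hq
  have hq0 : 0 ≤ q := by rw [hq, hc.hpr]; positivity
  -- the comparison constant
  set Cbig : ℝ := |c.ν| * (c.Ch * ((c.vB / 16) ^ q * (cS ^ (2 - c.θ) * cS' ^ (c.θ - 1)))) with hCbig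
  have hlim := Param.tendsto_Hν hc.hθ1 hc.hθ2 Cbig
  rw [← hc.hpr] at hlim
  refine tendsto_zero_of_abs_le hlim fun μ hμ => ?_
  obtain ⟨hS0, hS1, hS3⟩ := S₁_le T γ₀ M g hc hμ
  obtain ⟨hκ0, hκ1, -, hσ0, -, -, hm0, -⟩ := scheme_basic hc.hθ1 hc.hθ2 hμ
  have hμ0 : 0 < μ := zero_lt_one.trans_le hμ
  have hσ0' : (0 : ℝ) < σθ c.θ μ := by exact_mod_cast hσ0
  set κ := κθ c.θ μ
  set σ : ℝ := (σθ c.θ μ : ℝ)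
  set S₁ := c.S₁ (Dof T γ₀ M g c.θ μ)
  set L := (Dof T γ₀ M g c.θ μ).Lstar
  -- nonnegativity and the value of `Hν`
  have eH : c.Hν (Dof T γ₀ M g c.θ μ) = |c.ν| * (c.Ch * ((c.vB * (κ⁻¹ * (1 / 4 / μ) ^ 2)) ^ q * (S₁ ^ (2 - c.θ) * (3 * (S₁ * L ^ 2)) ^ (c.θ - 1)))) := rfl
  have hvE0 : 0 ≤ c.vB * (κ⁻¹ * (1 / 4 / μ) ^ 2) := by positivity
  have hH0 : 0 ≤ c.Hν (Dof T γ₀ M g c.θ μ) := by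
    rw [eH]
    have a1 : 0 ≤ (c.vB * (κ⁻¹ * (1 / 4 / μ) ^ 2)) ^ q := Real.rpow_nonneg hvE0 _
    have a2 : 0 ≤ S₁ ^ (2 - c.θ) := Real.rpow_nonneg hS0 _
    have a3 : 0 ≤ (3 * (S₁ * L ^ 2)) ^ (c.θ - 1) := Real.rpow_nonneg (by positivity) _
    positivity
  rw [abs_of_nonneg hH0, eH]
  -- compare factor by factor
  have hvE : c.vB * (κ⁻¹ * (1 / 4 / μ) ^ 2) = (c.vB / 16) * (κ⁻¹ * μ ^ (-(2 : ℝ))) := by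
    rw [Real.rpow_neg hμ0.le, Real.rpow_two]; field_simp; ring
  have f1 : (c.vB * (κ⁻¹ * (1 / 4 / μ) ^ 2)) ^ q = (c.vB / 16) ^ q * (κ⁻¹ * μ ^ (-(2 : ℝ))) ^ q := by
    rw [hvE, Real.mul_rpow (by positivity) (by positivity)]
  have f2 : S₁ ^ (2 - c.θ) ≤ cS ^ (2 - c.θ) * (σ * κ ^ (1 / 2 : ℝ) * μ ^ (2 : ℝ)) ^ (2 - c.θ) := by
    rw [← Real.mul_rpow hcS0 (by positivity)]
    exact Real.rpow_le_rpow hS0 hS1 (by linarith)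
  have f3 : (3 * (S₁ * L ^ 2)) ^ (c.θ - 1) ≤ cS' ^ (c.θ - 1) * (σ ^ (3 : ℝ) * κ ^ (1 / 2 : ℝ) * μ ^ (4 : ℝ)) ^ (c.θ - 1) := by
    rw [← Real.mul_rpow hcS'0 (by positivity)]
    exact Real.rpow_le_rpow (by positivity) hS3 (by linarith [hc.hθ1])
  have n2 : 0 ≤ (σ * κ ^ (1 / 2 : ℝ) * μ ^ (2 : ℝ)) ^ (2 - c.θ) := Real.rpow_nonneg (by positivity) _
  have n3 : 0 ≤ (σ ^ (3 : ℝ) * κ ^ (1 / 2 : ℝ) * μ ^ (4 : ℝ)) ^ (c.θ - 1) := Real.rpow_nonneg (by positivity) _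
  have n1 : 0 ≤ (κ⁻¹ * μ ^ (-(2 : ℝ))) ^ q := Real.rpow_nonneg (by positivity) _
  have f23 : S₁ ^ (2 - c.θ) * (3 * (S₁ * L ^ 2)) ^ (c.θ - 1) ≤
      (cS ^ (2 - c.θ) * cS' ^ (c.θ - 1)) * ((σ * κ ^ (1 / 2 : ℝ) * μ ^ (2 : ℝ)) ^ (2 - c.θ) * (σ ^ (3 : ℝ) * κ ^ (1 / 2 : ℝ) * μ ^ (4 : ℝ)) ^ (c.θ - 1)) := by
    calc _ ≤ (cS ^ (2 - c.θ) * (σ * κ ^ (1 / 2 : ℝ) * μ ^ (2 : ℝ)) ^ (2 - c.θ)) * (cS' ^ (c.θ - 1) * (σ ^ (3 : ℝ) * κ ^ (1 / 2 : ℝ) * μ ^ (4 : ℝ)) ^ (c.θ - 1)) :=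
          mul_le_mul f2 f3 (Real.rpow_nonneg (by positivity) _) (by positivity)
      _ = _ := by ring
  rw [f1]
  calc |c.ν| * (c.Ch * ((c.vB / 16) ^ q * (κ⁻¹ * μ ^ (-(2 : ℝ))) ^ q * (S₁ ^ (2 - c.θ) * (3 * (S₁ * L ^ 2)) ^ (c.θ - 1))))
      ≤ |c.ν| * (c.Ch * ((c.vB / 16) ^ q * (κ⁻¹ * μ ^ (-(2 : ℝ))) ^ q *
          ((cS ^ (2 - c.θ) * cS' ^ (c.θ - 1)) * ((σ * κ ^ (1 / 2 : ℝ) * μ ^ (2 : ℝ)) ^ (2 - c.θ) * (σ ^ (3 : ℝ) * κ ^ (1 / 2 : ℝ) * μ ^ (4 : ℝ)) ^ (c.θ - 1))))) := by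
        gcongr
    _ = Cbig * ((κ⁻¹ * μ ^ (-(2 : ℝ))) ^ q * ((σ * κ ^ (1 / 2 : ℝ) * μ ^ (2 : ℝ)) ^ (2 - c.θ) * (σ ^ (3 : ℝ) * κ ^ (1 / 2 : ℝ) * μ ^ (4 : ℝ)) ^ (c.θ - 1))) := by
        rw [hCbig]; ring

/-! ### The stress bound -/

/-- **Every size of the step tends to zero along the curve**: `stress → 0`, `incL1 → 0`,
`E_r → 0`, and the `σ⁻¹`-tail of `E_p → 0`. [cite: LuoTiti2020, §3.5 (3.21)] -/
theorem tendsto_stress : Tendsto (fun μ => c.stress (Dof T γ₀ M g c.θ μ)) atTop (𝓝 0) := by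
  have hEp : Tendsto (fun μ => c.Ep (Dof T γ₀ M g c.θ μ)) atTop (𝓝 (NN * (5 * (2 / radius (Fin 3) * (γ₀ + 3 * c.δM))))) := by
    have h := (tendsto_Ep_tail hc).const_add (NN * (5 * (2 / radius (Fin 3) * (γ₀ + 3 * c.δM))))
    rw [add_zero] at h
    refine h.congr fun μ => ?_
    show _ = NN * (5 * (2 / radius (Fin 3) * (γ₀ + 3 * c.δM) + 3 * c.H₁ * (Real.sqrt 3 / (σθ c.θ μ : ℝ))))
    ring
  have hEr := tendsto_Er T γ₀ M g hc
  have hLS := (tendsto_LS_Lf₂_Lf₃ T γ₀ M g hc).1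
  have hLf₂ := (tendsto_LS_Lf₂_Lf₃ T γ₀ M g hc).2.1
  have hLf₃ := (tendsto_LS_Lf₂_Lf₃ T γ₀ M g hc).2.2
  have hLf₁ := tendsto_Lf₁ T γ₀ M g hc
  have hLp := tendsto_Lp T γ₀ M g hc
  have hLc := tendsto_Lc T γ₀ M g hc
  have hEX := tendsto_EX T γ₀ M g hc
  have hEζ := tendsto_Eζ T γ₀ M g hc
  have hScLc := tendsto_ScLc T γ₀ M g hc
  have hinc := tendsto_incL1 T γ₀ M g hc
  have hH := tendsto_Hν T γ₀ M g hc
  -- piece 1: `2√Ep√Er + Er + LS + (2√(2(Ep+ScLc))√(2(EX+Eζ)) + 2(EX+Eζ))`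
  have p1 := ((((hEp.sqrt.mul hEr.sqrt).const_mul 2).add hEr).add hLS).add
    ((((((hEp.add hScLc).const_mul 2).sqrt.mul ((hEX.add hEζ).const_mul 2).sqrt).const_mul 2).add ((hEX.add hEζ).const_mul 2)))
  -- piece 2: `2 V₀ incL1`
  have p2 := hinc.const_mul (2 * c.V₀)
  -- piece 3: the sources
  have p3 := (((hLf₁.add ((hLf₂.add hLf₃).const_mul 2 |>.const_mul c.C₁)).add (((hLp.add hLc).const_mul c.C₁).const_mul c.Ψ₁)).add hLf₁).add
    ((hEX.sqrt.const_mul c.C₁).const_mul (2 * c.Ψ₁))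
  have := ((p1.add p2).add p3).add hH
  simp only [Real.sqrt_zero, mul_zero, add_zero] at this
  exact this

/-- **Eventually all four sizes are below any `ε > 0`.** [cite: LuoTiti2020, §3.5 (3.21)] -/
theorem eventually_small {ε : ℝ} (hε : 0 < ε) :
    ∀ᶠ μ in atTop, c.stress (Dof T γ₀ M g c.θ μ) < ε ∧ c.incL1 (Dof T γ₀ M g c.θ μ) < ε ∧ c.Er (Dof T γ₀ M g c.θ μ) < ε ∧
      NN * (5 * (3 * c.H₁ * (Real.sqrt 3 / (σθ c.θ μ : ℝ)))) < ε := by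
  have h1 := (tendsto_stress T γ₀ M g hc).eventually (gt_mem_nhds hε)
  have h2 := (tendsto_incL1 T γ₀ M g hc).eventually (gt_mem_nhds hε)
  have h3 := (tendsto_Er T γ₀ M g hc).eventually (gt_mem_nhds hε)
  have h4 := (tendsto_Ep_tail hc).eventually (gt_mem_nhds hε)
  filter_upwards [h1, h2, h3, h4] with μ a b c' d
  exact ⟨a, b, c', d⟩

end Consts

end LuoTiti

end Literature.Analysis.FluidPDE

/-! # Part 2: the Iteration Lemma -/


open MeasureTheory Set Filter Topology Function UnitAddTorus
open scoped InnerProductSpace ContDiff ENNReal NNReal Manifold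

namespace Literature.Analysis.FluidPDE

namespace LuoTiti

open Literature.Analysis.FunctionSpaces FunctionSpaces.Torus Mikado NashGeometric Jet JetStep Param

local notation "𝕋³" => UnitAddTorus (Fin 3)
local notation "E³" => EuclideanSpace ℝ (Fin 3)
local notation "Idx" => Index (Fin 3)

/-! ## A smooth temporal cut-off -/

/-- **Smooth cut-off of a bounded set of times**: for bounded `K ⊆ ℝ` and `δ > 0` there is a smooth
`ψ : ℝ → [0, 1]`, equal to `1` on `K`, compactly supported inside the `δ`-neighbourhood of `K`
(smooth Urysohn lemma). [cite: LuoTiti2020, §3.3 ("`ψ(t)` a smooth cut-off function such that `ψ = 1` on `supp_t R_q`, `supp ψ ⊂ N_{δ_{q+1}}(supp_t R_q)`")] -/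
theorem exists_smooth_cutoff {K : Set ℝ} (hK : Bornology.IsBounded K) {δ : ℝ} (hδ : 0 < δ) :
    ∃ ψ : ℝ → ℝ, ContDiff ℝ ∞ ψ ∧ (∀ t, 0 ≤ ψ t ∧ ψ t ≤ 1) ∧ (∀ t ∈ K, ψ t = 1) ∧
      tsupport ψ ⊆ Metric.thickening δ K ∧ HasCompactSupport ψ := by
  have hs : IsClosed (Metric.thickening (δ / 2) K)ᶜ := Metric.isOpen_thickening.isClosed_compl
  have ht : IsClosed (closure K) := isClosed_closure
  have hd : Disjoint (Metric.thickening (δ / 2) K)ᶜ (closure K) := by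
    rw [disjoint_compl_left_iff_subset]
    exact Metric.closure_subset_thickening (half_pos hδ) K
  obtain ⟨f, hf0, hf1, hf01⟩ := exists_contMDiffMap_zero_one_of_isClosed (I := 𝓘(ℝ, ℝ)) (M := ℝ) (n := ⊤) hs ht hd
  have hsub : tsupport f ⊆ Metric.thickening δ K := by
    have h1 : Function.support f ⊆ Metric.thickening (δ / 2) K := by
      intro t ht
      by_contra hn
      exact ht (hf0 hn)
    calc tsupport f ⊆ closure (Metric.thickening (δ / 2) K) := closure_mono h1
      _ ⊆ Metric.cthickening (δ / 2) K := Metric.closure_thickening_subset_cthickening _ _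
      _ ⊆ Metric.thickening δ K := Metric.cthickening_subset_thickening' hδ (by linarith) K
  refine ⟨f, contMDiff_iff_contDiff.1 f.contMDiff, fun t => ⟨(hf01 t).1, (hf01 t).2⟩, fun t ht => hf1 (subset_closure ht), hsub, ?_⟩
  exact Metric.isCompact_of_isClosed_isBounded (isClosed_tsupport _) ((hK.thickening).subset hsub)

/-- `sup|ψ′| < ∞` for a smooth compactly supported `ψ`. [folklore] -/
theorem exists_bound_deriv {ψ : ℝ → ℝ} (hψ : ContDiff ℝ ∞ ψ) (hc : HasCompactSupport ψ) : ∃ Ψ₁ : ℝ, ∀ t, |deriv ψ t| ≤ Ψ₁ := by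
  obtain ⟨C, hC⟩ := (hψ.continuous_deriv (by simp)).bounded_above_of_compact_support hc.deriv
  exact ⟨C, fun t => by simpa [Real.norm_eq_abs] using hC t⟩

/-! ## Compactness bounds of a smooth field on a slab -/

/-- **Uniform bounds of a jointly smooth field and its first/second space derivatives and of the
time derivatives of the field and of its first space derivatives on a compact slab** (the
hypotheses `b0, b1, b1t, b2, b2t` of `JAmp.jamp_package`). [folklore] -/
theorem exists_slab_bounds {T : ℝ} (hT : 0 < T) {M : ℝ → 𝕋³ → Fin 3 → E³} (hM : Torus.IsSmoothSpaceTimeOn (Icc 0 T) M) :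
    ∃ DM : ℝ, 0 ≤ DM ∧ (∀ t ∈ Icc 0 T, ∀ y, ‖M t y‖ ≤ DM) ∧ (∀ t ∈ Icc 0 T, ∀ y l, ‖Torus.partialDeriv l (M t) y‖ ≤ DM) ∧
      (∀ t ∈ Icc 0 T, ∀ y, ‖Torus.timeDerivWithin (Icc 0 T) M t y‖ ≤ DM) ∧
      (∀ t ∈ Icc 0 T, ∀ y l m, ‖Torus.partialDeriv m (Torus.partialDeriv l (M t)) y‖ ≤ DM) ∧
      (∀ t ∈ Icc 0 T, ∀ y l, ‖Torus.timeDerivWithin (Icc 0 T) (fun s z => Torus.partialDeriv l (M s) z) t y‖ ≤ DM) := by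
  have hU : UniqueDiffOn ℝ (Icc 0 T) := uniqueDiffOn_Icc hT
  have hKc : IsCompact (Icc (0 : ℝ) T) := isCompact_Icc
  obtain ⟨C, hC0, hC⟩ := exists_hasDerivBounds_of_isSmoothSpaceTimeOn hU hKc subset_rfl 2 hM
  obtain ⟨Ct, hCt0, hCt⟩ := exists_hasDerivBounds_of_isSmoothSpaceTimeOn hU hKc subset_rfl 0 (hM.timeDerivWithin hU)
  have hl : ∀ l : Fin 3, ∃ Cl : ℝ, 0 ≤ Cl ∧ ∀ t ∈ Icc 0 T, HasDerivBounds 0 (Torus.timeDerivWithin (Icc 0 T) (fun s z => Torus.partialDeriv l (M s) z) t) Cl 1 :=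
    fun l => exists_hasDerivBounds_of_isSmoothSpaceTimeOn hU hKc subset_rfl 0 ((hM.partialDeriv hU l).timeDerivWithin hU)
  choose Cl hCl0 hCl using hl
  refine ⟨C + Ct + ∑ l, Cl l, by have := Finset.sum_nonneg fun l (_ : l ∈ Finset.univ) => hCl0 l; positivity, ?_, ?_, ?_, ?_, ?_⟩
  · intro t ht y
    have := (hC t ht).norm_le y
    have hs := Finset.sum_nonneg fun l (_ : l ∈ Finset.univ) => hCl0 l
    linarith
  · intro t ht y l
    have := (hC t ht).norm_partialDeriv_le (by norm_num) l y
    have hs := Finset.sum_nonneg fun l (_ : l ∈ Finset.univ) => hCl0 l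
    linarith
  · intro t ht y
    have := (hCt t ht).norm_le y
    have hs := Finset.sum_nonneg fun l (_ : l ∈ Finset.univ) => hCl0 l
    linarith
  · intro t ht y l m
    have h2 := (hC t ht).2 [m, l] (by simp) y
    simp only [iterPartialDeriv_cons, iterPartialDeriv_nil, List.length_cons, List.length_nil, one_pow, mul_one] at h2
    have hs := Finset.sum_nonneg fun l (_ : l ∈ Finset.univ) => hCl0 l
    linarith
  · intro t ht y l
    have := (hCl l t ht).norm_le y
    have hle : Cl l ≤ ∑ l', Cl l' := Finset.single_le_sum (f := Cl) (fun l' _ => hCl0 l') (Finset.mem_univ l)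
    linarith

/-! ## The Iteration Lemma -/

set_option maxHeartbeats 4000000 in
/-- **The Iteration Lemma of Luo–Titi** (`Torus.LuoTiti2020_iterationLemma`), proved.
[cite: LuoTiti2020, §2.1 Iteration Lemma (Lemma 1 of arXiv:1808.07595), §3] -/
theorem iterationLemma_holds : Torus.LuoTiti2020_iterationLemma := by
  intro θ ν hθ1 hθ54 hν
  have hθ2 : θ < 2 := by linarith
  have hθ0 : 0 < θ := by linarith
  have hr := radius_pos Datum.hd3 (d := Fin 3)
  have hNN : 0 < NN := zero_lt_one.trans_le one_le_NN
  set Cu : ℝ := Real.sqrt (40 * NN / radius (Fin 3) + 1) + 1 with hCu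
  refine ⟨Cu, by positivity, ?_⟩
  intro v p R δ₁ δ₂ hv hbdd hδ₁ hδ₂ hRδ
  -- Step 0: the temporal support in `[-r, r]`, the translation by `c₀ = r + 2δ₁`, the slab `[0, T]`
  obtain ⟨r₀, hr₀⟩ := hbdd.subset_closedBall (0 : ℝ)
  set r : ℝ := max r₀ 0 with hrdef
  have hr0 : 0 ≤ r := le_max_right _ _
  have hsupp : Function.support v ∪ Function.support R ⊆ Metric.closedBall (0 : ℝ) r :=
    hr₀.trans (Metric.closedBall_subset_closedBall (le_max_left _ _))
  set c₀ : ℝ := r + 2 * δ₁ with hc₀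
  set T : ℝ := 2 * r + 4 * δ₁ with hTdef
  have hT : 0 < T := by positivity
  set V : ℝ → 𝕋³ → E³ := fun t => v (t - c₀) with hVdef
  set P : ℝ → 𝕋³ → ℝ := fun t => p (t - c₀) with hPdef
  set M : ℝ → 𝕋³ → Fin 3 → E³ := fun t => R (t - c₀) with hMdef
  have hV : Torus.IsFracNSReynoldsOn univ θ ν V P M := hv.comp_sub_time c₀
  have hin : ∀ t, (V t ≠ 0 ∨ M t ≠ 0) → t ∈ Icc (2 * δ₁) (T - 2 * δ₁) := by
    intro t ht
    have hmem : t - c₀ ∈ Function.support v ∪ Function.support R := by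
      rcases ht with h1 | h1
      · exact Or.inl (Function.mem_support.2 h1)
      · exact Or.inr (Function.mem_support.2 h1)
    have hb := hsupp hmem
    rw [Metric.mem_closedBall, Real.dist_eq, sub_zero, abs_le] at hb
    obtain ⟨hb1, hb2⟩ := hb
    constructor <;> linarith
  have hMδ : ∀ t, ∫ y, ‖M t y‖ ≤ δ₁ := fun t => hRδ (t - c₀)
  have hM_univ : Torus.IsSmoothSpaceTimeOn univ M := hV.smooth_stress
  have hM_Icc : Torus.IsSmoothSpaceTimeOn (Icc 0 T) M := hM_univ.mono (subset_univ _)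
  -- Step 1: the cut-off
  have hKb : Bornology.IsBounded (Function.support M) := by
    refine (Metric.isBounded_Icc (2 * δ₁) (T - 2 * δ₁)).subset fun t ht => hin t (Or.inr (Function.mem_support.1 ht))
  obtain ⟨ψ, hψs, hψ01, hψK, hψsupp, hψc⟩ := exists_smooth_cutoff hKb hδ₁
  have hψIoo : tsupport ψ ⊆ Ioo 0 T := by
    intro t ht
    obtain ⟨z, hz, hdist⟩ := Metric.mem_thickening_iff.1 (hψsupp ht)
    have hzI := hin z (Or.inr (Function.mem_support.1 hz))
    rw [Real.dist_eq, abs_lt] at hdist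
    constructor <;> linarith [hzI.1, hzI.2]
  obtain ⟨Ψ₁, hΨ₁⟩ := exists_bound_deriv hψs hψc
  -- Step 2: the bump and the parameter-free constants
  obtain ⟨gfam, hgb, hg1, -⟩ := Intermittent.exists_isBump_disjoint (Fin 1)
  set g : ℝ → ℝ := gfam 0 with hgdef
  have hg : Intermittent.IsBump g := hgb 0
  have hgn : ∫ s in (0 : ℝ)..1, g s ^ 2 = 1 := hg1 0
  obtain ⟨B, hB1, hBall⟩ := Jet.exists_bounds hg
  obtain ⟨Kb, hKb0, hKball⟩ := Datum.exists_blockBounds hg 4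
  obtain ⟨C₂, hC₂⟩ := FunctionSpaces.Torus.eLpNorm_hessian_le_laplacian_holds (d := Fin 3) 2 (by norm_num) (by norm_num)
  obtain ⟨C₁, hC₁⟩ := Torus.exists_eLpNorm_antidivergence_le (d := Fin 3) Datum.hd3 (p := 1) le_rfl
  obtain ⟨g0, g1, p1, p2, -, -⟩ := gap_bounds hθ1 hθ54
  have hp1' : (1 : ℝ≥0∞) < ENNReal.ofReal (pexp θ) := by
    rw [← ENNReal.ofReal_one]; exact (ENNReal.ofReal_lt_ofReal_iff (by linarith)).2 p1
  obtain ⟨Cℛ, hCℛ⟩ := Torus.exists_eLpNorm_antidivergence_tensorDivergence_le (d := Fin 3) Datum.hd3 hp1' ENNReal.ofReal_lt_top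
  obtain ⟨Ch, hCh⟩ := Torus.exists_eLpNorm_one_antidivergence_fracLaplacian_le (d := Fin 3) Datum.hd3 hθ1 hθ2 hp1' ENNReal.ofReal_lt_top
  -- Step 3: compactness constants
  obtain ⟨DM, hDM0, b0, b1, b1t, b2, b2t⟩ := exists_slab_bounds hT hM_Icc
  have hU : UniqueDiffOn ℝ (Icc 0 T) := uniqueDiffOn_Icc hT
  obtain ⟨V₀, hV₀0, hV₀⟩ := exists_hasDerivBounds_of_isSmoothSpaceTimeOn hU isCompact_Icc subset_rfl 0 (hV.smooth_velocity.mono (subset_univ _))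
  have ha' : ∀ x : Idx, ∃ Cx : ℝ, 0 ≤ Cx ∧ ∀ t ∈ Icc 0 T, HasDerivBounds 4 (JAmp.jamp δ₁ M x t) Cx 1 := fun x =>
    exists_hasDerivBounds_of_isSmoothSpaceTimeOn hU isCompact_Icc subset_rfl 4 (JAmp.isSmoothSpaceTimeOn_jamp Datum.hd3 hδ₁ hM_Icc x)
  choose Cx hCx0 hCx using ha'
  set Ca : ℝ := ∑ x, Cx x with hCa
  have hCa0 : 0 ≤ Ca := Finset.sum_nonneg fun x _ => hCx0 x
  have hCxle : ∀ x, Cx x ≤ Ca := fun x => Finset.single_le_sum (f := Cx) (fun x _ => hCx0 x) (Finset.mem_univ x)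
  -- Step 4: the amplitude constants (Θ = 1, Y = max 1 (DM/δ₁))
  set Y : ℝ := max 1 (DM / δ₁) with hYdef
  have hY1 : 1 ≤ Y := le_max_left _ _
  have hY0 : 0 ≤ Y := by linarith
  have hD0 : DM ≤ δ₁ * Y := by
    have : DM / δ₁ ≤ Y := le_max_right _ _
    rw [div_le_iff₀ hδ₁] at this; linarith
  set A₀ : ℝ := JAmp.ampConst (Fin 3) * Real.sqrt (δ₁ * Y) with hA₀def
  set A₁ : ℝ := JAmp.ampConst (Fin 3) * Real.sqrt δ₁ * Y ^ 2 * 1 with hA₁def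
  set A₂ : ℝ := JAmp.ampConst (Fin 3) * Real.sqrt δ₁ * Y ^ 4 * 1 ^ 2 with hA₂def
  set H₁ : ℝ := JAmp.ampConst (Fin 3) * δ₁ * Y ^ 2 * 1 with hH₁def
  set H₂ : ℝ := JAmp.ampConst (Fin 3) * δ₁ * Y ^ 4 * 1 ^ 2 with hH₂def
  have hCa_d : 0 ≤ JAmp.ampConst (Fin 3) := by unfold JAmp.ampConst; positivity
  have hpack := fun x {t} (ht : t ∈ Icc 0 T) y l m => JAmp.jamp_package (d := Fin 3) (γ₀ := δ₁) (R := M) Datum.hd3 hδ₁ hM_Icc hU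
    hY1 le_rfl hDM0 hDM0 hDM0 hD0 (by linarith) (by linarith) b0 b1 b1t b2 b2t x ht y l m
  -- the constants record
  set vB : ℝ := ∑ x : Idx, (volume (Metric.ball (0 : EuclideanSpace ℝ (Slot x)) 1)).toReal with hvB
  have hvB0 : 0 ≤ vB := Finset.sum_nonneg fun x _ => ENNReal.toReal_nonneg
  have hA₀0 : 0 ≤ A₀ := by positivity
  have hA₁0 : 0 ≤ A₁ := by positivity
  have hH₁0 : 0 ≤ H₁ := by positivity
  have hH₂0 : 0 ≤ H₂ := by positivity
  have hΨ0 : 0 ≤ Ψ₁ := (abs_nonneg _).trans (hΨ₁ 0)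
  set cc : Consts := ⟨A₀, A₁, A₂, H₁, H₂, B, C₂, Cℛ, C₁, Ch, Kb, Ca, V₀, Ψ₁, δ₁, pexp θ, θ, ν, vB⟩ with hcc
  have hcn : cc.Nonneg := ⟨hA₀0, hA₁0, hH₁0, hH₂0, hB1, C₂.coe_nonneg, Cℛ.coe_nonneg, C₁.coe_nonneg,
    Ch.coe_nonneg, hKb0, hCa0, hV₀0, hΨ0, hvB0, hθ1, hθ54, rfl⟩
  -- Step 5: the large parameter
  have hε : 0 < min δ₁ δ₂ := lt_min hδ₁ hδ₂
  have hev := (Consts.eventually_small T δ₁ M g hcn hε).and (eventually_ge_atTop (max pipeConc 1))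
  obtain ⟨μ, ⟨hstress, hinc, hEr, htail⟩, hμ⟩ := hev.exists
  have hμp : pipeConc ≤ μ := le_trans (le_max_left _ _) hμ
  have hμ1 : 1 ≤ μ := le_trans (le_max_right _ _) hμ
  obtain ⟨hκ0, hκ1, hκμ, hσ0, -, -, hm0, -⟩ := scheme_basic hθ1 hθ54 hμ1
  -- Step 6: the datum and the set-up
  set D : Datum := Dof T δ₁ M g θ μ with hDdef
  have hD : D.Valid := ⟨hT, hδ₁, hM_Icc, fun t _ y i j => hV.symm t (mem_univ t) y i j, hμp, hκ1, hσ0, hm0, hg, hgn⟩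
  set S : Setup := ⟨D, ψ⟩ with hSdef
  have hS : S.Valid := by
    refine ⟨hD, hψs, hψ01, hψIoo, fun t => ?_⟩
    by_cases ht : M t = 0
    · exact Or.inr ht
    · exact Or.inl (hψK t (Function.mem_support.2 ht))
  -- Step 7: admissibility of the constants
  have hAmp : D.AmpBounds A₀ A₁ A₂ H₁ H₂ := by
    refine ⟨by positivity, by positivity, by positivity, by positivity, by positivity, ?_, ?_, ?_, ?_, ?_, ?_, ?_, ?_, ?_⟩
    · intro x t ht y
      have h0 := (hpack x ht y 0 0).1
      show |JAmp.jamp δ₁ M x t y| ≤ A₀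
      rw [abs_of_nonneg h0.1]; exact h0.2
    · intro x t ht y l; exact (hpack x ht y l 0).2.1
    · intro x t ht y; exact (hpack x ht y 0 0).2.2.1
    · intro x t ht y l m; exact (hpack x ht y l m).2.2.2.1
    · intro x t ht y l; exact (hpack x ht y l 0).2.2.2.2.1
    · intro x t ht y l; exact (hpack x ht y l 0).2.2.2.2.2.1
    · intro x t ht y; exact (hpack x ht y 0 0).2.2.2.2.2.2.1
    · intro x t ht y l m; exact (hpack x ht y l m).2.2.2.2.2.2.2.1
    · intro x t ht y l; exact (hpack x ht y l 0).2.2.2.2.2.2.2.2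
  have hV₀' : ∀ t ∈ Icc 0 S.D.T, ∀ y, ‖V t y‖ ≤ V₀ := fun t ht y => (hV₀ t ht).norm_le y
  have hAdm : cc.Admissible S V := by
    refine ⟨hAmp, hB1, fun x t => hBall (D.J x) rfl (Datum.Jvalid hD x) D.s x t, C₂.coe_nonneg, ?_, p1, p2, Cℛ.coe_nonneg, ?_,
      C₁.coe_nonneg, ?_, Ch.coe_nonneg, ?_, hKball D hD rfl hκμ, hκμ, ?_, hV₀', hΨ₁, hMδ, le_rfl, hθ1, hθ2⟩
    · intro w hw j k
      show _ ≤ ENNReal.ofReal (C₂ : ℝ) * _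
      rw [ENNReal.ofReal_coe_nnreal]; exact hC₂ w hw j k
    · intro A hA
      show _ ≤ ENNReal.ofReal (Cℛ : ℝ) * _
      rw [ENNReal.ofReal_coe_nnreal]; exact hCℛ A hA
    · intro g' hg'
      show _ ≤ ENNReal.ofReal (C₁ : ℝ) * _
      rw [ENNReal.ofReal_coe_nnreal]; exact hC₁ g' hg'
    · intro u hu E hE h1 h3 S₁ S₃ hS₁ hS₃ k1 k3
      show _ ≤ ENNReal.ofReal (Ch : ℝ) * _
      rw [ENNReal.ofReal_coe_nnreal]
      exact hCh u hu E hE h1 h3 S₁ S₃ hS₁ hS₃ k1 k3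
    · intro x t ht
      exact (hCx x t ht).mono (hCxle x) zero_le_one le_rfl
  -- Step 8: the step bounds and the new triple
  obtain ⟨bL2, bL1, bst⟩ := Setup.step_bounds hS hV (c := cc) hAdm rfl rfl
  have hnew := Setup.isFracNSReynoldsOn_new hS hθ0 hV (p := P)
  set V' : ℝ → 𝕋³ → E³ := fun t y => V t y + S.w t y with hV'def
  set P' : ℝ → 𝕋³ → ℝ := Setup.newPressure θ ν S P with hP'def
  set M' : ℝ → 𝕋³ → Fin 3 → E³ := Setup.newStress θ ν S V with hM'def
  have hVt : ∀ t, V (t - (-c₀)) = v t := fun t => by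
    show v (t - (-c₀) - c₀) = v t
    congr 1; ring
  have hwt : ∀ s, S.w s ≠ 0 → ∃ z, R z ≠ 0 ∧ |s - c₀ - z| < δ₁ := by
    intro s hs
    have hs' : s ∈ tsupport ψ := Setup.support_w_subset (S := S) (Function.mem_support.2 hs)
    obtain ⟨z, hz, hdist⟩ := Metric.mem_thickening_iff.1 (hψsupp hs')
    refine ⟨z - c₀, Function.mem_support.1 hz, ?_⟩
    rw [Real.dist_eq] at hdist
    have e : s - c₀ - (z - c₀) = s - z := by ring
    rw [e]; exact hdist
  -- Step 9: translate back and read off the five conclusions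
  refine ⟨fun t => V' (t - (-c₀)), fun t => P' (t - (-c₀)), fun t => M' (t - (-c₀)), hnew.comp_sub_time (-c₀), ?_, ?_, ?_, ?_⟩
  · -- the `L¹` size of the new stress
    intro t
    exact ((bst (t - (-c₀))).trans (le_of_lt hstress)).trans (min_le_right _ _)
  · -- the temporal supports
    intro t ht
    rcases ht with ht | ht
    · have hne : V' (t - (-c₀)) ≠ 0 := Function.mem_support.1 ht
      by_cases hw : S.w (t - (-c₀)) = 0
      · have hV0 : V (t - (-c₀)) ≠ 0 := by
          intro h0
          apply hne
          funext y
          show V (t - (-c₀)) y + S.w (t - (-c₀)) y = 0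
          rw [h0, hw]; simp
        rw [hVt t] at hV0
        exact Metric.self_subset_thickening hδ₁ _ (Or.inl (Function.mem_support.2 hV0))
      · obtain ⟨z, hz, hd⟩ := hwt _ hw
        refine Metric.mem_thickening_iff.2 ⟨z, Or.inr (Function.mem_support.2 hz), ?_⟩
        rw [Real.dist_eq]
        have e : t - z = t - (-c₀) - c₀ - z := by ring
        rw [e]; exact hd
    · have hne : M' (t - (-c₀)) ≠ 0 := Function.mem_support.1 ht
      have hs : (t - (-c₀)) ∈ tsupport ψ := by
        by_contra hn
        exact hne ((Setup.w_newStress_eq_zero_of_not_mem (S := S) (θ := θ) (ν := ν) V hn).2)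
      obtain ⟨z, hz, hdist⟩ := Metric.mem_thickening_iff.1 (hψsupp hs)
      refine Metric.mem_thickening_iff.2 ⟨z - c₀, Or.inr (Function.mem_support.2 (Function.mem_support.1 hz)), ?_⟩
      rw [Real.dist_eq] at hdist ⊢
      have e : t - (z - c₀) = t - (-c₀) - z := by ring
      rw [e]; exact hdist
  · -- the `L²` size of the increment
    intro t
    have e : (fun t => V' (t - (-c₀))) t - v t = S.w (t - (-c₀)) := by
      funext y
      show V (t - (-c₀)) y + S.w (t - (-c₀)) y - v t y = S.w (t - (-c₀)) y
      rw [hVt t]; abel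
    rw [e]
    refine (bL2 _).trans (ENNReal.ofReal_le_ofReal ?_)
    show Real.sqrt (cc.Ep S.D) + Real.sqrt (cc.Er S.D) ≤ Cu * Real.sqrt δ₁
    have hEp : cc.Ep S.D ≤ (40 * NN / radius (Fin 3) + 1) * δ₁ := by
      have ht' : NN * (5 * (3 * H₁ * (Real.sqrt 3 / (σθ θ μ : ℝ)))) ≤ δ₁ := (le_of_lt htail).trans (min_le_left _ _)
      show NN * (5 * (2 / radius (Fin 3) * (δ₁ + 3 * δ₁) + 3 * H₁ * (Real.sqrt 3 / (σθ θ μ : ℝ)))) ≤ _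
      have e1 : NN * (5 * (2 / radius (Fin 3) * (δ₁ + 3 * δ₁) + 3 * H₁ * (Real.sqrt 3 / (σθ θ μ : ℝ)))) =
          40 * NN / radius (Fin 3) * δ₁ + NN * (5 * (3 * H₁ * (Real.sqrt 3 / (σθ θ μ : ℝ)))) := by
        field_simp; ring
      rw [e1]
      linarith
    have hEr' : cc.Er S.D ≤ δ₁ := (le_of_lt hEr).trans (min_le_left _ _)
    have h40 : 0 ≤ 40 * NN / radius (Fin 3) + 1 := by positivity
    calc Real.sqrt (cc.Ep S.D) + Real.sqrt (cc.Er S.D) ≤ Real.sqrt ((40 * NN / radius (Fin 3) + 1) * δ₁) + Real.sqrt δ₁ :=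
          add_le_add (Real.sqrt_le_sqrt hEp) (Real.sqrt_le_sqrt hEr')
      _ = Cu * Real.sqrt δ₁ := by rw [Real.sqrt_mul h40, hCu]; ring
  · -- the `L¹` size of the increment
    intro t
    have e : ∀ y, (fun t => V' (t - (-c₀))) t y - v t y = S.w (t - (-c₀)) y := by
      intro y
      show V (t - (-c₀)) y + S.w (t - (-c₀)) y - v t y = S.w (t - (-c₀)) y
      rw [hVt t]; abel
    simp_rw [e]
    exact ((bL1 _).trans (le_of_lt hinc)).trans (min_le_right _ _)

/-- The named fact `Torus.LuoTiti2020_iterationLemma`, discharged. [cite: LuoTiti2020, §2.1 Iteration Lemma] -/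
theorem _root_.Literature.Analysis.FluidPDE.Torus.LuoTiti2020_iterationLemma_holds : Torus.LuoTiti2020_iterationLemma :=
  iterationLemma_holds

end LuoTiti

end Literature.Analysis.FluidPDE
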